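import Literature.MathematicalPhysics.QuantumFieldTheory.Balaban1983to89.B6Cor28KLevelV1
import Literature.MathematicalPhysics.QuantumFieldTheory.Balaban1983to89.B6HolderPairMemberV1
import Literature.MathematicalPhysics.QuantumFieldTheory.Balaban1983to89.B6GradLegKLevelV1
import HarnessLib

/-!
# `Balaban1983to89.B6Cor28HolderEntryKLevelV1` — T. Bałaban, *Propagators and renormalization transformations for lattice gauge theories. II*,
Comm. Math. Phys. **96** (1984) 223–250 [Balaban1984PropagatorsII], **Corollary 2.8, the HÖLDER entry `‖(ζ∇H)(·, c)‖_α` of (2.151) p. 249 AT k LEVELS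
for the genuine `H = GQ*(QGQ*)⁻¹ = GE ∘ QsE ∘ EE (domT hN D hk)` — ITS PAIR DIFFERENCES `(∇_νHe_c)(x) − (∇_νHe_c)(x′)`, MODULO the k-level (2.137)₁
majorant of the pair AND the level-weighted (2.147)** on ROUTE V's V1 torus (B6-CLOSURE §5 item 20, first file; owner r03): the composition step
`B6Cor28KLevelV1.comp_entry_le` («Prop. 2.6 ∘ Prop. 2.7 via Lemma 2.1», generic in the left factor) for the LEFT FACTOR `T = P_{x,x′}·∇_νG`
(`pairOp x x′ * DV ν c_f * onFun GE`, p22's pair-difference operator `B6HolderPairMemberV1.pairOp` of the Hölder quotient (1.109)) fed with a DISPLAYED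
(2.137)₁-type majorant `F(y)·e^{−δ₃d_T(y,y′)}` of that left factor and (2.149) modulo (2.147) (`B6Prop27KLevelV1.prop27_kLevel`, p368756).  The two
displayed inputs are discharged by name in the sequel: the majorant by p22's k-level (2.137)₁ `B6Ineq2137GradKLevelV1.ineq2137_grad_kLevel` (kernel-clean by
concatenation 2026-08-24T02:30Z, queued; its conclusion is LITERALLY the hypothesis shape below with `F(y) = A·t^α·(L^{j(y)}η)`, rate `delta3 β (2σ)`), (2.147) by
ROUTE W part W1 (`B6QGQCoerciveKLevelV1.qgq_coercive_kLevel`, `γ := γ₀`).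

HONEST FRAMING (programme rule): statement-level skeleton of published theorems with citation tags; proofs where landed; nothing here
is a claim about the Yang–Mills mass gap.

WHAT IS PRINTED (p. 249): «|H(b,c)|, |(∇H)(b,c)|, ‖(ζ∇H)(·,c)‖_α ≤ O(1)[1, (L^jη)^{−1}, (L^jη)^{−1−α}(‖ζ‖^ξ_α + |ζ|)](L^{j′}η)^{−d}e^{−δ₅d(y,c₋)}, (1.151)[sic]
b ∈ Δ(y) or supp ζ ⊂ Δ(y), y ∈ Λ_j, c₋ ∈ Λ_{j′}»; (1.109) of [4] «‖A‖_α = max_μ sup_{x,x′: |x−x′| ≤ 1} |x − x′|^{−α}|A_μ(x) − A_μ(x′)|»; p. 247 (2.137)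
«‖ζ∇GJ‖_α ≤ O(1)(Lʲη)^{1−α}(‖ζ‖^ξ_α + |ζ|)e^{−δ₃d(y,y′)}|J|»; p. 248 (2.147) «⟨B, (QG_□Q*)B⟩ ≥ γ₀‖B‖²» (here level-weighted and global).  By the generic
composition step with `T = P_{x,x′}·∇_νG` and a (2.137)₁ majorant `F(y)e^{−δ₃d_T}` of it, `F(y) = A·t^α·(L^{j(y)}η)` (`t = |x − x′|/L^{j}` the dimensionless
pair parameter, `η = |c_f|⁻¹`), the surviving output ratio is `F/pref = A·t^α·(L^jη)^{−1}` — print's `(L^jη)^{−1−α}·|x − x′|_phys^α` with `|x − x′|_phys =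
t·L^jη`, i.e. the third entry of (2.151) before the cut-off dressing `(‖ζ‖^ξ_α + |ζ|)` (p22's product rule `B6HolderPairMemberV1.abs_cutoff_pair_le` with the
second entry `|(∇H)(b,c)|`, left to the census file).

## WHAT THIS FILE CERTIFIES (kernel-checked, sorry-free, standard axioms; THEOREMS ONLY)

* `holderPair_entry_le`: the composition step for `T = P_{x,x′}·∇_νG` with a generic majorant `F(y)e^{−δ₃d_T}` (hypotheses as in
  `B6Cor28KLevelV1.H_entry_le`): `|(∇_νHe_c)(x) − (∇_νHe_c)(x′)| ≤ (F/pref)(y(x))·C·e^{−(1−α′)(δ/2)d_T(y(x), βc)}`;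
* `ratio_holder`: `A·(w·(len(y)·|c_f|⁻¹))/pref(y) = A·w·(len(y)·|c_f|⁻¹)⁻¹` (the output ratio for `F = A·(w·(L^jη))`, `w = t^α`, p22's association);
* **`cor28_kLevel_holder_of_2137_2147`** = COROLLARY 2.8, THE PAIR DIFFERENCES OF THE HÖLDER ENTRY (2.151)₃, AT k LEVELS for the genuine `H`, MODULO a
  displayed (2.137)₁-majorant of `P_{x,x′}·∇_νG` at rate `delta3 α (2σ)` AND the level-weighted (2.147): binders of `B6Prop27KLevelV1.prop27_kLevel` VERBATIM
  (`γ > 0` free; `N₁` enlarged), `∀ γ ∃ δ₅ > 0, C ≥ 0, M₂, N₁`: for EVERY direction `ν`, pair of fine bonds `x, x′`, weight `F ≥ 0` with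
  `HasMajorant (pairOp x x′ * DV ν c_f * onFun GE) (F(y)e^{−delta3 α (2σ)·d_T})`, and index bond `c`:
  `|(∇_νHe_c)(x) − (∇_νHe_c)(x′)| ≤ C·(F/pref)(y(x))·e^{−δ₅d_T(y(x), β c)}`;
* `cor28_kLevel_holder_of_2137_2147_len`: the same with `F(y) = A·(w·(len(y)·|c_f|⁻¹))`, conclusion `C·(A·w·(len(y(x))·|c_f|⁻¹)⁻¹)·e^{−δ₅d_T}` — the shape fed
  by p22's theorem (`w = t^α`).

## HONEST SCOPE

(1) TWO displayed hypotheses (binders, not vendored facts; both have named dischargers, see above): the (2.137)₁-type majorant of the pair operator and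
(2.147).  The cut-off dressing `(‖ζ‖^ξ_α + |ζ|)`, the Hölder seminorm as a supremum over admissible pairs and the census typing `B6.Cor28Printed (d+1)` on this
family are NOT in this file (census file of item 20, after p22's (2.137)₁ and `B6Cor28EntriesKLevelV1` land).  (2) `d(y, c₋)` := p21's torus graph distance
(2.46) between the block `blkV1 x` and the carrier block `β c`; flat `ℓ²` entries of `H` (print's kernel `H(b,c)` carries the (2.150) weight `(L^{j(c)}η)^d`,
which cancels the census factor `(L^{j′}η)^{−d}` — as in `B6Cor28KLevelV1`).  (3) `δ₅ = (15/32)·δ₄`, `δ₄ = min(δ₃/4, (γ/A′)/(16D·c/δ₃ + 1))`, `δ₃ = delta3 α (2σ)`;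
`C` ours (print: «O(1)», «δ₅» depending on `d, L`).  (4) Setting = that of `prop27_kLevel` (V1 torus, `k ≥ 2`, `M_h = L^a ≥ 8`, `R ≥ 2L²`, `P′ ≥ 5`,
`L ≥ 5` odd, `Placed`, band (2.16), `M₂ ≤ L·M_h`, `N₁ + 1 ≤ R·L·M_h`); no admissibility condition on the pair is needed HERE (it enters only through the
displayed majorant).  (5) The expansion form of `H` is not re-derived.  NOT summit progress.  Unit `lit-balaban-r03` (gen 25), 2026-08-24.
-/

namespace Literature.MathematicalPhysics.QuantumFieldTheory.Balaban1983to89.B6Cor28HolderEntryKLevelV1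

open scoped InnerProductSpace
open LatticeFieldCalculus
open B6SectAOperatorsV1 (QE QsE BondIdx BondIdxSpace)
open B6SectAVectorModelV1 (GE EE)
open B6Ineq2133TwoScaleV1 (onFun onFun_apply)
open B6RandomWalk (HasMajorant delta3)
open B6MultiLevelBoxOperator (N0)
open B6MultiLevelTorusOperator (TDomains)
open B6GlobalChartV1 (PV domT blkV1)
open B6Geom246MultiLevelBox (bset)
open B6Geom246MultiLevelTorus (geomT lemma21_torus)
open B8Ineq192MultiLevelTorus (lenT_eq lenT_pos)
open B6Ineq261LevelGap (K261 K261_nonneg)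
open B6Lemma21Repaired (Ineq263With)
open B6Prop26KLevelSkeletonV1 (pref pref_nonneg)
open B6Ineq2142KLevelV1 (lvl β qwt)
open B6Prop27KLevelV1 (lam card_fiber_beta_le)
open B6GradLegKLevelV1 (DV)
open B6HolderPairMemberV1 (pairOp pairOp_apply)
open B6Cor28KLevelV1 (comp_entry_le pref_pos two_le_RMh absorb_threshold theta_threshold)
open B6CubeWindowV1 (Placed GlobalBand)
open B6Cover236MultiLevelBlocks (cubes)

noncomputable section

variable {d ℓ m K : ℕ} {hd : 1 ≤ d + 1} {hL : Odd (ℓ + 1) ∧ 1 < ℓ + 1}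
variable {Mh k R : ℕ} {P' : Fin (d + 1) → ℕ}

section Pair

variable (hN : ∀ μ, N0 ℓ Mh k P' μ = (PV d ℓ m K hd hL).sitesPerDir 0) (D : TDomains d ℓ Mh k P' R) (hk : k ≤ m + K)
variable {cf : ℝ} (hcf : cf ≠ 0) {w : BondIdx (domT hN D hk) → ℝ} (hw : ∀ i, 0 < w i)

/-- **THE OUTPUT RATIO OF THE HÖLDER ENTRY**: for `F = A·w·(L^jη)` (`w = t^α`), `F/pref = A·w·(L^jη)^{−1}`, i.e.
`A·w·(len(y)·|c_f|⁻¹)/pref(y) = A·w·(len(y)·|c_f|⁻¹)⁻¹` (`η = |c_f|⁻¹`) — print's `(L^jη)^{−1−α}|x − x′|_phys^α` with `|x − x′|_phys = t·L^jη`.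
[cite: Balaban1984PropagatorsII, Cor. 2.8 (2.151) p.249 (the factor `(L^jη)^{−1−α}`), bookkeeping] -/
theorem ratio_holder {cf : ℝ} (hcf : cf ≠ 0) (A w : ℝ) (y : ↥(bset D.toDomains)) :
    A * (w * ((geomT D).len y * |cf|⁻¹)) / pref cf (D := D) y = A * w * ((geomT D).len y * |cf|⁻¹)⁻¹ := by
  have hcast : (((ℓ + 1 : ℕ) : ℝ)) = (ℓ : ℝ) + 1 := by push_cast; ring
  have hlen := lenT_pos (D := D) y
  have habs : 0 < |cf| := abs_pos.2 hcf
  have hpref : pref cf (D := D) y = ((geomT D).len y) ^ 2 / |cf| ^ 2 := by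
    unfold pref; rw [hcast, lenT_eq, div_pow, sq_abs]
  rw [hpref]
  field_simp

open Classical in
/-- **THE PAIR DIFFERENCE OF `∇_νH` AT `(x, x′)`** (`T = P_{x,x′}·∇_νG = pairOp x x′ * DV ν c_f * onFun G` with a (2.137)₁-type majorant `F(y)·e^{−δ₃d_T}`):
by the generic composition step `B6Cor28KLevelV1.comp_entry_le`, `|(∇_νHe_c)(x) − (∇_νHe_c)(x′)| ≤ (F/pref)(y(x))·C·e^{−(1−α′)(δ/2)d_T(y(x), βc)}`.
[cite: Balaban1984PropagatorsII, Cor. 2.8 (2.151) p.249 (entry `‖(ζ∇H)(·,c)‖_α`), (2.137) p.247, (2.149) p.249, Lemma 2.1 (2.63) p.234] -/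
theorem holderPair_entry_le (hk1 : 1 ≤ k) (hRM : 2 ≤ R * Mh) (hMh : 1 ≤ Mh) (hP : ∀ μ, 1 ≤ P' μ)
    {F : ↥(bset D.toDomains) → ℝ} {δ₃ Cγ δ c63 α' : ℝ} (hF : ∀ y, 0 ≤ F y) (hCγ : 0 ≤ Cγ) (hδ : 0 < δ) (hδ3 : δ ≤ δ₃)
    (ν : Fin (d + 1)) (x x' : PBond (PV d ℓ m K hd hL) 0)
    (hT : HasMajorant (g := geomT D) (blkV1 hN D) (pairOp x x' * DV (P := PV d ℓ m K hd hL) ν cf * onFun (GE (domT hN D hk) hcf hw))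
      (fun y y' => F y * Real.exp (-(δ₃ * (geomT D).dist y y'))))
    (h2149 : ∀ c' c : BondIdx (domT hN D hk),
      |⟪EuclideanSpace.single c' (1 : ℝ), EE (domT hN D hk) hcf hw (EuclideanSpace.single c (1 : ℝ))⟫_ℝ| ≤
        (lam hN D hk cf c')⁻¹ * (lam hN D hk cf c)⁻¹ * (Cγ * Real.exp (-(δ * (geomT D).dist (β hN D hk c') (β hN D hk c)))))
    (hsmall : ((ℓ : ℝ) + 1) ^ (d + 3) * Real.exp (-(δ / 2 * ((R : ℝ) * (((ℓ : ℝ) + 1) * Mh) - 1))) ≤ 1)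
    (h263 : Ineq263With c63 (geomT D) (δ / 2) α')
    (c : BondIdx (domT hN D hk)) :
    |(DV (P := PV d ℓ m K hd hL) ν cf ∘ₗ onFun (GE (domT hN D hk) hcf hw ∘ₗ QsE (domT hN D hk) ∘ₗ EE (domT hN D hk) hcf hw)) (Pi.single c 1) x -
      (DV (P := PV d ℓ m K hd hL) ν cf ∘ₗ onFun (GE (domT hN D hk) hcf hw ∘ₗ QsE (domT hN D hk) ∘ₗ EE (domT hN D hk) hcf hw)) (Pi.single c 1) x'| ≤
      F (blkV1 hN D x) / pref cf (blkV1 hN D x) *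
        (Cγ * (2 * (((ℓ + 1 : ℕ) : ℝ)) ^ (d + 1) * Real.exp (δ₃ * ((ℓ : ℝ) + 3))) * ((ℓ : ℝ) + 1) ^ 2 * ((ℓ : ℝ) + 1) ^ (d + 3) *
          (2 * ((d : ℝ) + 1)) * c63 ^ 2) * Real.exp (-((1 - α') * (δ / 2) * (geomT D).dist (blkV1 hN D x) (β hN D hk c))) := by
  have h := comp_entry_le hN D hk hcf hw hk1 hRM hMh hP
    (T := pairOp x x' * DV (P := PV d ℓ m K hd hL) ν cf * onFun (GE (domT hN D hk) hcf hw)) (F := F) hF hCγ hδ hδ3 hT h2149 hsmall h263 c x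
  -- `(P_{x,x′}·∇_νG) ∘ (Q*·(QGQ*)⁻¹) = P_{x,x′}·(∇_νG·Q*·(QGQ*)⁻¹)` and its value at `x` is the pair difference
  have heq : (pairOp x x' * DV (P := PV d ℓ m K hd hL) ν cf * onFun (GE (domT hN D hk) hcf hw)) ∘ₗ
        onFun (QsE (domT hN D hk) ∘ₗ EE (domT hN D hk) hcf hw) =
      pairOp x x' ∘ₗ (DV (P := PV d ℓ m K hd hL) ν cf ∘ₗ
        onFun (GE (domT hN D hk) hcf hw ∘ₗ QsE (domT hN D hk) ∘ₗ EE (domT hN D hk) hcf hw)) := by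
    rw [B6Cor28KLevelV1.onFun_comp (GE (domT hN D hk) hcf hw) (QsE (domT hN D hk) ∘ₗ EE (domT hN D hk) hcf hw)]
    simp only [Module.End.mul_eq_comp, LinearMap.comp_assoc]
  rw [heq, LinearMap.comp_apply, pairOp_apply, if_pos rfl] at h
  exact h

end Pair

/-! ## Corollary 2.8, the pair differences of the Hölder entry (2.151)₃ at k levels, modulo (2.137)₁ and the level-weighted (2.147) -/

section Main

open B6Prop27KLevelV1 (wt)

open Classical in
/-- **[B6] COROLLARY 2.8, THE PAIR DIFFERENCES `(∇_νHe_c)(x) − (∇_νHe_c)(x′)` OF THE HÖLDER ENTRY `‖(ζ∇H)(·,c)‖_α` OF (2.151), AT k LEVELS FOR THE GENUINE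
`H = GQ*(QGQ*)⁻¹ = GE ∘ QsE ∘ EE`, MODULO a displayed (2.137)₁-majorant of `P_{x,x′}·∇_νG` AND the level-weighted (2.147)** (binders of
`B6Prop27KLevelV1.prop27_kLevel` verbatim — its displayed coercivity (2.147) `γΣ_iΛ_i²v_i² ≤ ⟪Q*v, GQ*v⟫` with a free `γ > 0` on which the constants depend —
the threshold `N₁` enlarged): for every `σ ∈ (0, σ₁]`, `α ∈ (0, 1)`, `γ > 0` there are `δ₅ > 0`, `C ≥ 0`, `M₂ > 0`, `N₁` such that for every such torus family,
weights in the band, `QGQ*` coercive with `γ`, EVERY direction `ν`, pair of fine bonds `x, x′`, weight `F ≥ 0` with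
`HasMajorant (pairOp x x′ * DV ν c_f * onFun GE) (F(y)·e^{−delta3 α (2σ)·d_T(y,y′)})` (the conclusion shape of p22's k-level (2.137)₁
`B6Ineq2137GradKLevelV1.ineq2137_grad_kLevel`, rate parameter `β := α`, `F(y) = A·t^α·(len(y)·|c_f|⁻¹)`), and EVERY index bond `c`:
`|(∇_νHe_c)(x) − (∇_νHe_c)(x′)| ≤ C·(F/pref)(y(x))·e^{−δ₅·d_T(y(x), β c)}` (print: «‖(ζ∇H)(·,c)‖_α ≤ O(1)(L^jη)^{−1−α}(‖ζ‖^ξ_α + |ζ|)(L^{j′}η)^{−d}e^{−δ₅d(y,c₋)}»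
with the (2.150) weight of the flat entries; `(F/pref)(y) = A·t^α·(L^jη)^{−1}` for p22's `F`).  Inputs BY NAME: (2.149) modulo (2.147) `B6Prop27KLevelV1.prop27_kLevel`,
Lemma 2.1 (2.63) on the torus `B6Geom246MultiLevelTorus.lemma21_torus`, the composition step `B6Cor28KLevelV1.comp_entry_le`.
[cite: Balaban1984PropagatorsII, Cor. 2.8 (2.150)–(2.151) p.249, Prop. 2.6 (2.137) p.247, Prop. 2.7 (2.147)–(2.149) p.248–249, Lemma 2.1 (2.60)–(2.63) p.234] -/
theorem cor28_kLevel_holder_of_2137_2147 (d ℓ : ℕ) (hd : 1 ≤ d + 1) (hL : Odd (ℓ + 1) ∧ 1 < ℓ + 1) {b₀ b₁ : ℝ} (hb₀ : 0 < b₀) (hb₁ : b₀ ≤ b₁) :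
    ∃ σ₁ : ℝ, 0 < σ₁ ∧ ∀ (σ : ℝ), 0 < σ → σ ≤ σ₁ → ∀ (α : ℝ), 0 < α → α < 1 → ∀ (γ : ℝ), 0 < γ →
    ∃ (δ₅ C M₂ : ℝ) (N₁ : ℕ), 0 < δ₅ ∧ 0 ≤ C ∧ 0 < M₂ ∧
    ∀ (m K : ℕ) {Mh k R : ℕ} {P' : Fin (d + 1) → ℕ}
      (hN : ∀ μ, N0 ℓ Mh k P' μ = (PV d ℓ m K hd hL).sitesPerDir 0) (D : TDomains d ℓ Mh k P' R) (hk : k ≤ m + K) (_ : 2 ≤ k)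
      {a : ℕ} (_ : Mh = (ℓ + 1) ^ a) (_ : 8 ≤ Mh) (_ : 2 * (ℓ + 1) ^ 2 ≤ R) (_ : ∀ μ, 5 ≤ P' μ) (_ : 4 ≤ ℓ)
      (_ : ∀ c : ↥(cubes D.toDomains), Placed ℓ k P' c.1) (_ : M₂ ≤ ((ℓ : ℝ) + 1) * Mh) (_ : N₁ + 1 ≤ R * ((ℓ + 1) * Mh))
      {cf : ℝ} (hcf : cf ≠ 0) {w : BondIdx (domT hN D hk) → ℝ} (hw : ∀ i, 0 < w i) (_ : GlobalBand b₀ b₁ cf w)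
      (_ : ∀ v : BondIdxSpace (domT hN D hk), γ * ∑ i, wt hN D hk cf i * v i ^ 2 ≤
        ⟪QsE (domT hN D hk) v, GE (domT hN D hk) hcf hw (QsE (domT hN D hk) v)⟫_ℝ)
      (ν : Fin (d + 1)) (x x' : PBond (PV d ℓ m K hd hL) 0) {F : ↥(bset D.toDomains) → ℝ} (_ : ∀ y, 0 ≤ F y)
      (_ : HasMajorant (g := geomT D) (blkV1 hN D) (pairOp x x' * DV (P := PV d ℓ m K hd hL) ν cf * onFun (GE (domT hN D hk) hcf hw))
        (fun y y' => F y * Real.exp (-(delta3 α (2 * σ) * (geomT D).dist y y'))))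
      (c : BondIdx (domT hN D hk)),
      |(DV (P := PV d ℓ m K hd hL) ν cf ∘ₗ onFun (GE (domT hN D hk) hcf hw ∘ₗ QsE (domT hN D hk) ∘ₗ EE (domT hN D hk) hcf hw)) (Pi.single c 1) x -
        (DV (P := PV d ℓ m K hd hL) ν cf ∘ₗ onFun (GE (domT hN D hk) hcf hw ∘ₗ QsE (domT hN D hk) ∘ₗ EE (domT hN D hk) hcf hw)) (Pi.single c 1) x'| ≤
        C * (F (blkV1 hN D x) / pref cf (blkV1 hN D x)) * Real.exp (-(δ₅ * (geomT D).dist (blkV1 hN D x) (β hN D hk c))) := by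
  obtain ⟨σ₂, hσ₂, h27⟩ := B6Prop27KLevelV1.prop27_kLevel d ℓ hd hL hb₀ hb₁
  refine ⟨σ₂, hσ₂, fun σ hσ hσ1 α hα hα1 γ hγ0 => ?_⟩
  obtain ⟨A', M₂', c, N₁, hA', hM₂', hc, hEE⟩ := h27 σ hσ hσ1 α hα hα1
  clear h27
  -- the rates
  set δ₃ : ℝ := delta3 α (2 * σ) with hδ₃
  have hδ₃pos : 0 < δ₃ := B6RandomWalk.delta3_pos hα1 (by linarith)
  set δ₄ : ℝ := min (δ₃ / 4) (γ / A' / (2 * (1 * (4 / δ₃) * (2 * ((d : ℝ) + 1) * c)) + 1)) with hδ₄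
  have hδ₄pos : 0 < δ₄ := by
    rw [hδ₄]
    refine lt_min (by linarith) (div_pos (div_pos hγ0 hA') ?_)
    have : 0 ≤ 2 * (1 * (4 / δ₃) * (2 * ((d : ℝ) + 1) * c)) := by positivity
    linarith
  have hδ₄le : δ₄ ≤ δ₃ := (min_le_left _ _).trans (by linarith)
  -- the threshold of (2.63) on the torus at rate `δ₄/2`, `α′ = 1/16`
  obtain ⟨hN₂pos, hθ⟩ := theta_threshold d ℓ hδ₄pos
  set N₂ : ℕ := ⌈64 * ((d : ℝ) + 1) * ((ℓ : ℝ) + 1) / δ₄⌉₊ + 1 with hN₂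
  set c63 : ℝ := K261 N₂ (d + 1) ((ℓ : ℝ) + 1) 1 (1 / 16 * (δ₄ / 2)) with hc63
  -- the absorption threshold `N₃ ≥ 2(d+3)L/δ₄`
  obtain ⟨N₃, hN₃⟩ : ∃ N₃ : ℕ, N₃ = ⌈2 * ((d : ℝ) + 3) * ((ℓ : ℝ) + 1) / δ₄⌉₊ + 1 := ⟨_, rfl⟩
  have hN₃ge : 2 * ((d : ℝ) + 3) * ((ℓ : ℝ) + 1) ≤ δ₄ * (N₃ : ℝ) := by
    have h1 : 2 * ((d : ℝ) + 3) * ((ℓ : ℝ) + 1) / δ₄ ≤ (N₃ : ℝ) := by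
      rw [hN₃]; push_cast; exact (Nat.le_ceil _).trans (by linarith)
    rw [div_le_iff₀ hδ₄pos] at h1; linarith
  -- constants
  set C : ℝ := 2 / γ * (2 * (((ℓ + 1 : ℕ) : ℝ)) ^ (d + 1) * Real.exp (δ₃ * ((ℓ : ℝ) + 3))) * ((ℓ : ℝ) + 1) ^ 2 *
    ((ℓ : ℝ) + 1) ^ (d + 3) * (2 * ((d : ℝ) + 1)) * c63 ^ 2 with hC
  have hc63_0 : 0 ≤ c63 := K261_nonneg (by positivity) zero_le_one
  have hC0 : 0 ≤ C := by positivity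
  refine ⟨(1 - 1 / 16) * (δ₄ / 2), C, M₂', max (max N₁ N₂) N₃, by positivity, hC0, hM₂', ?_⟩
  intro m K Mh k R P' hN D hk hk2 a hMha hM8 hR2 hP5 hℓ hpl hM hRM cf hcf w hw hwb hγ ν x x' F hF hT c'
  have hk1 : 1 ≤ k := le_trans one_le_two hk2
  have hMh : 1 ≤ Mh := le_trans (by norm_num) hM8
  have hP : ∀ μ, 1 ≤ P' μ := fun μ => le_trans (by norm_num) (hP5 μ)
  have hRM2 : 2 ≤ R * Mh := two_le_RMh hR2 hM8
  -- (2.149) modulo (2.147)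
  have h2149 := hEE m K hN D hk hk2 hMha hM8 hR2 hP5 hℓ hpl hM
    (le_trans (Nat.succ_le_succ ((le_max_left _ _).trans (le_max_left _ _))) hRM) hcf hw hwb hγ0 hγ
  clear hEE
  -- (2.63) on the torus at rate `δ₄/2`, `α′ = 1/16`
  have hRM2' : N₂ + 1 ≤ R * ((ℓ + 1) * Mh) := le_trans (Nat.succ_le_succ ((le_max_right _ _).trans (le_max_left _ _))) hRM
  obtain ⟨-, -, -, h263⟩ := lemma21_torus D hMh hP hN₂pos hRM2' (δ₀ := δ₄ / 2) (α := 1 / 16) (by positivity) (by norm_num) (by norm_num) hθ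
  -- the absorption threshold
  have hN₃le : (N₃ : ℝ) ≤ (R : ℝ) * (((ℓ : ℝ) + 1) * Mh) - 1 := by
    have h1 : N₃ + 1 ≤ R * ((ℓ + 1) * Mh) := le_trans (Nat.succ_le_succ (le_max_right _ _)) hRM
    have h2 : ((N₃ + 1 : ℕ) : ℝ) ≤ ((R * ((ℓ + 1) * Mh) : ℕ) : ℝ) := by exact_mod_cast h1
    push_cast at h2; linarith
  have hsmall : ((ℓ : ℝ) + 1) ^ (d + 3) * Real.exp (-(δ₄ / 2 * ((R : ℝ) * (((ℓ : ℝ) + 1) * Mh) - 1))) ≤ 1 :=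
    absorb_threshold hδ₄pos hN₃ge hN₃le
  have h := holderPair_entry_le hN D hk hcf hw hk1 hRM2 hMh hP hF (by positivity : (0 : ℝ) ≤ 2 / γ) hδ₄pos hδ₄le ν x x'
    hT (fun z z' => h2149 z z') hsmall h263 c'
  rw [hC]
  calc _ ≤ _ := h
    _ = _ := by ring

open Classical in
/-- **THE SAME IN THE SHAPE FED BY p22's (2.137)₁** (`F(y) = A·w·(len(y)·|c_f|⁻¹)`, `w = t^α` the pair weight, `A, w ≥ 0`): conclusion
`|(∇_νHe_c)(x) − (∇_νHe_c)(x′)| ≤ C·A·w·(len(y(x))·|c_f|⁻¹)⁻¹·e^{−δ₅·d_T(y(x), β c)}` — print's `O(1)(L^jη)^{−1−α}|x − x′|_phys^α e^{−δ₅d}` per flat entry.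
[cite: Balaban1984PropagatorsII, Cor. 2.8 (2.151) p.249, Prop. 2.6 (2.137) p.247, Prop. 2.7 (2.147)–(2.149) p.248–249] -/
theorem cor28_kLevel_holder_of_2137_2147_len (d ℓ : ℕ) (hd : 1 ≤ d + 1) (hL : Odd (ℓ + 1) ∧ 1 < ℓ + 1) {b₀ b₁ : ℝ} (hb₀ : 0 < b₀) (hb₁ : b₀ ≤ b₁) :
    ∃ σ₁ : ℝ, 0 < σ₁ ∧ ∀ (σ : ℝ), 0 < σ → σ ≤ σ₁ → ∀ (α : ℝ), 0 < α → α < 1 → ∀ (γ : ℝ), 0 < γ →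
    ∃ (δ₅ C M₂ : ℝ) (N₁ : ℕ), 0 < δ₅ ∧ 0 ≤ C ∧ 0 < M₂ ∧
    ∀ (m K : ℕ) {Mh k R : ℕ} {P' : Fin (d + 1) → ℕ}
      (hN : ∀ μ, N0 ℓ Mh k P' μ = (PV d ℓ m K hd hL).sitesPerDir 0) (D : TDomains d ℓ Mh k P' R) (hk : k ≤ m + K) (_ : 2 ≤ k)
      {a : ℕ} (_ : Mh = (ℓ + 1) ^ a) (_ : 8 ≤ Mh) (_ : 2 * (ℓ + 1) ^ 2 ≤ R) (_ : ∀ μ, 5 ≤ P' μ) (_ : 4 ≤ ℓ)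
      (_ : ∀ c : ↥(cubes D.toDomains), Placed ℓ k P' c.1) (_ : M₂ ≤ ((ℓ : ℝ) + 1) * Mh) (_ : N₁ + 1 ≤ R * ((ℓ + 1) * Mh))
      {cf : ℝ} (hcf : cf ≠ 0) {w : BondIdx (domT hN D hk) → ℝ} (hw : ∀ i, 0 < w i) (_ : GlobalBand b₀ b₁ cf w)
      (_ : ∀ v : BondIdxSpace (domT hN D hk), γ * ∑ i, wt hN D hk cf i * v i ^ 2 ≤
        ⟪QsE (domT hN D hk) v, GE (domT hN D hk) hcf hw (QsE (domT hN D hk) v)⟫_ℝ)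
      (ν : Fin (d + 1)) (x x' : PBond (PV d ℓ m K hd hL) 0) {A wt' : ℝ} (_ : 0 ≤ A) (_ : 0 ≤ wt')
      (_ : HasMajorant (g := geomT D) (blkV1 hN D) (pairOp x x' * DV (P := PV d ℓ m K hd hL) ν cf * onFun (GE (domT hN D hk) hcf hw))
        (fun y y' => A * (wt' * ((geomT D).len y * |cf|⁻¹)) * Real.exp (-(delta3 α (2 * σ) * (geomT D).dist y y'))))
      (c : BondIdx (domT hN D hk)),
      |(DV (P := PV d ℓ m K hd hL) ν cf ∘ₗ onFun (GE (domT hN D hk) hcf hw ∘ₗ QsE (domT hN D hk) ∘ₗ EE (domT hN D hk) hcf hw)) (Pi.single c 1) x -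
        (DV (P := PV d ℓ m K hd hL) ν cf ∘ₗ onFun (GE (domT hN D hk) hcf hw ∘ₗ QsE (domT hN D hk) ∘ₗ EE (domT hN D hk) hcf hw)) (Pi.single c 1) x'| ≤
        C * (A * wt' * ((geomT D).len (blkV1 hN D x) * |cf|⁻¹)⁻¹) * Real.exp (-(δ₅ * (geomT D).dist (blkV1 hN D x) (β hN D hk c))) := by
  obtain ⟨σ₁, hσ₁, h⟩ := cor28_kLevel_holder_of_2137_2147 d ℓ hd hL hb₀ hb₁
  refine ⟨σ₁, hσ₁, fun σ hσ hσ1 α hα hα1 γ hγ0 => ?_⟩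
  obtain ⟨δ₅, C, M₂, N₁, hδ₅, hC, hM₂, hK⟩ := h σ hσ hσ1 α hα hα1 γ hγ0
  refine ⟨δ₅, C, M₂, N₁, hδ₅, hC, hM₂, ?_⟩
  intro m K Mh k R P' hN D hk hk2 a hMha hM8 hR2 hP5 hℓ hpl hM hRM cf hcf w hw hwb hγ ν x x' A wt' hA hwt hT c'
  have hF : ∀ y : ↥(bset D.toDomains), 0 ≤ A * (wt' * ((geomT D).len y * |cf|⁻¹)) := fun y =>
    mul_nonneg hA (mul_nonneg hwt (mul_nonneg (lenT_pos (D := D) y).le (inv_nonneg.2 (abs_nonneg _))))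
  have h1 := hK m K hN D hk hk2 hMha hM8 hR2 hP5 hℓ hpl hM hRM hcf hw hwb hγ ν x x' hF hT c'
  rw [ratio_holder D hcf] at h1
  exact h1

end Main

end

end Literature.MathematicalPhysics.QuantumFieldTheory.Balaban1983to89.B6Cor28HolderEntryKLevelV1
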